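import Mathlib.Data.Real.Basic
import Mathlib.Algebra.BigOperators.Ring.Finset
import Mathlib.Algebra.Order.BigOperators.Group.Finset
import Mathlib.Tactic.Linarith
import Mathlib.Tactic.Ring
import Mathlib.Tactic.Positivity
import HarnessLib

/-!
# The covariance-gluing (dendrogram / martingale-increment) lemma behind prim-lf-2's certificate schema for the coefficientwise first rung

Support file (`--supports stmt-CriticalPhenomena-4575`, closed), prover `prim-lf-2` (gen 25).  No definitions, no named facts, no sorries; standard axioms.
Memo `prim-lf-2/CW-MARTINGALE-gen25.md` §1 (Lemma M).

Context.  For a finite weighted set `(s, w)` and two functions `F, G` put `W = Σ w`, `A = Σ w F`, `B = Σ w G`, `C = Σ w F G` and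
`N(s) := W·C − A·B` (`= W² · Cov_w(F,G)`).  Splitting `s` by a predicate into `s₁ ⊔ s₀` one has the exact identity (law of total covariance, cleared of
denominators)
  `W₁ W₀ · N(s) = W₀ W · N(s₁) + W₁ W · N(s₀) + (W₀ A₁ − W₁ A₀)(W₀ B₁ − W₁ B₀)`,
whose last factor is `W₁² W₀² (mean₁ F − mean₀ F)(mean₁ G − mean₀ G)`.  Hence (`w ≥ 0`): if `F, G` are nonnegatively correlated on each half and their
MEANS MOVE THE SAME WAY across the split, they are nonnegatively correlated on `s` (`Coefficientwise.cov_glue_nonneg`).  Iterated along any binary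
dendrogram of the support of a swap-invariant measure this is the martingale identity `E[ΔfΔg] = Σ_nodes μ(h) p(1−p) ∂_h(Δf) ∂_h(Δg)` of the memo: a tree all of
whose splits are `Δ-uniform' certifies `E_S[Δf·Δg] ≥ 0`, i.e. the two-colouring (coefficientwise) form of van den Berg–Häggström–Kahn's conditional positive
association for that instance; such certificates exist for every rooted graph on ≤ 6 vertices (memo §2).  The cell theorem of gen 23
(`Coefficientwise.offCluster_twoColouring_nonneg`) is the special case "explore the red cluster of the avoided set, then product leaves".
[cite: KozmaNitzan2024, Questions 8–9 (§5.5 p. 36) (context: the first rung of the coefficientwise programme for Question 8)]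
-/

namespace Summit.CriticalPhenomena.PercolationContinuityZ3.Theorems

open Finset

namespace Coefficientwise

variable {α : Type*}

/-- The weighted covariance numerator `N(s) = (Σ_s w)(Σ_s w F G) − (Σ_s w F)(Σ_s w G)` of two functions on a finite weighted set.
(An abbreviation-free statement is used in the lemmas; this docstring fixes the notation of the file.)
Law of total covariance, cleared of denominators: for a split `s = s.filter p ⊔ s.filter (¬p)` with part weights `W₁, W₀`,
`W₁ W₀ N(s) = W₀ (W₁+W₀) N(s₁) + W₁ (W₁+W₀) N(s₀) + (W₀ A₁ − W₁ A₀)(W₀ B₁ − W₁ B₀)`.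
[cite: KozmaNitzan2024, §5.5 (context only; the identity is elementary)] -/
theorem cov_split_identity (s : Finset α) (p : α → Prop) [DecidablePred p] (w F G : α → ℝ) :
    (∑ a ∈ s.filter p, w a) * (∑ a ∈ s.filter (fun a => ¬ p a), w a) *
        ((∑ a ∈ s, w a) * (∑ a ∈ s, w a * (F a * G a)) - (∑ a ∈ s, w a * F a) * (∑ a ∈ s, w a * G a))
      = (∑ a ∈ s.filter (fun a => ¬ p a), w a) * (∑ a ∈ s, w a) *
          ((∑ a ∈ s.filter p, w a) * (∑ a ∈ s.filter p, w a * (F a * G a))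
            - (∑ a ∈ s.filter p, w a * F a) * (∑ a ∈ s.filter p, w a * G a))
        + (∑ a ∈ s.filter p, w a) * (∑ a ∈ s, w a) *
          ((∑ a ∈ s.filter (fun a => ¬ p a), w a) * (∑ a ∈ s.filter (fun a => ¬ p a), w a * (F a * G a))
            - (∑ a ∈ s.filter (fun a => ¬ p a), w a * F a) * (∑ a ∈ s.filter (fun a => ¬ p a), w a * G a))
        + ((∑ a ∈ s.filter (fun a => ¬ p a), w a) * (∑ a ∈ s.filter p, w a * F a)
            - (∑ a ∈ s.filter p, w a) * (∑ a ∈ s.filter (fun a => ¬ p a), w a * F a))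
          * ((∑ a ∈ s.filter (fun a => ¬ p a), w a) * (∑ a ∈ s.filter p, w a * G a)
            - (∑ a ∈ s.filter p, w a) * (∑ a ∈ s.filter (fun a => ¬ p a), w a * G a)) := by
  -- every full sum splits as (filter p) + (filter ¬p)
  have hW := (sum_filter_add_sum_filter_not s p w).symm
  have hA := (sum_filter_add_sum_filter_not s p (fun a => w a * F a)).symm
  have hB := (sum_filter_add_sum_filter_not s p (fun a => w a * G a)).symm
  have hC := (sum_filter_add_sum_filter_not s p (fun a => w a * (F a * G a))).symm
  rw [hW, hA, hB, hC]
  ring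

/-- **Covariance gluing.**  Nonnegative weights; `F, G` nonnegatively correlated (in the numerator sense `W·ΣwFG ≥ (ΣwF)(ΣwG)`) on each half of a
split; and the weighted means of `F` and of `G` move in the SAME direction across the split
(`(W₀A₁ − W₁A₀)(W₀B₁ − W₁B₀) ≥ 0`).  Then `F, G` are nonnegatively correlated on the whole set.  This is the inductive step of the
dendrogram/martingale certificate of `prim-lf-2/CW-MARTINGALE-gen25.md` §1 ("Δ-uniform split").
[cite: KozmaNitzan2024, §5.5 (context only)] -/
theorem cov_glue_nonneg (s : Finset α) (p : α → Prop) [DecidablePred p] (w F G : α → ℝ)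
    (hw : ∀ a ∈ s, 0 ≤ w a)
    (h₁ : (∑ a ∈ s.filter p, w a * F a) * (∑ a ∈ s.filter p, w a * G a)
            ≤ (∑ a ∈ s.filter p, w a) * (∑ a ∈ s.filter p, w a * (F a * G a)))
    (h₀ : (∑ a ∈ s.filter (fun a => ¬ p a), w a * F a) * (∑ a ∈ s.filter (fun a => ¬ p a), w a * G a)
            ≤ (∑ a ∈ s.filter (fun a => ¬ p a), w a) * (∑ a ∈ s.filter (fun a => ¬ p a), w a * (F a * G a)))
    (hmono : 0 ≤ ((∑ a ∈ s.filter (fun a => ¬ p a), w a) * (∑ a ∈ s.filter p, w a * F a)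
                    - (∑ a ∈ s.filter p, w a) * (∑ a ∈ s.filter (fun a => ¬ p a), w a * F a))
                 * ((∑ a ∈ s.filter (fun a => ¬ p a), w a) * (∑ a ∈ s.filter p, w a * G a)
                    - (∑ a ∈ s.filter p, w a) * (∑ a ∈ s.filter (fun a => ¬ p a), w a * G a))) :
    (∑ a ∈ s, w a * F a) * (∑ a ∈ s, w a * G a) ≤ (∑ a ∈ s, w a) * (∑ a ∈ s, w a * (F a * G a)) := by
  set W₁ := ∑ a ∈ s.filter p, w a with hW₁
  set W₀ := ∑ a ∈ s.filter (fun a => ¬ p a), w a with hW₀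
  have hW₁0 : 0 ≤ W₁ := sum_nonneg fun a ha => hw a (mem_of_mem_filter a ha)
  have hW₀0 : 0 ≤ W₀ := sum_nonneg fun a ha => hw a (mem_of_mem_filter a ha)
  have hid := cov_split_identity s p w F G
  -- degenerate halves: if a half has total weight 0 then all its weights vanish and the claim is the other half's hypothesis
  have vanish : ∀ (q : α → Prop) [DecidablePred q], (∑ a ∈ s.filter q, w a) = 0 →
      ∀ (H : α → ℝ), (∑ a ∈ s.filter q, w a * H a) = 0 := by
    intro q _ hq H
    have hz : ∀ a ∈ s.filter q, w a = 0 :=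
      (sum_eq_zero_iff_of_nonneg fun a ha => hw a (mem_of_mem_filter a ha)).mp hq
    exact sum_eq_zero fun a ha => by rw [hz a ha, zero_mul]
  by_cases h1z : W₁ = 0
  · -- everything lives on the `¬p` half
    have hA := vanish p (by rw [← hW₁]; exact h1z)
    have eW : (∑ a ∈ s, w a) = W₀ := by
      rw [← sum_filter_add_sum_filter_not s p w, ← hW₁, h1z, zero_add]
    have eA : (∑ a ∈ s, w a * F a) = ∑ a ∈ s.filter (fun a => ¬ p a), w a * F a := by
      rw [← sum_filter_add_sum_filter_not s p, hA F, zero_add]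
    have eB : (∑ a ∈ s, w a * G a) = ∑ a ∈ s.filter (fun a => ¬ p a), w a * G a := by
      rw [← sum_filter_add_sum_filter_not s p, hA G, zero_add]
    have eC : (∑ a ∈ s, w a * (F a * G a)) = ∑ a ∈ s.filter (fun a => ¬ p a), w a * (F a * G a) := by
      rw [← sum_filter_add_sum_filter_not s p, hA (fun a => F a * G a), zero_add]
    rw [eW, eA, eB, eC, hW₀]; exact h₀
  by_cases h0z : W₀ = 0
  · have hA := vanish (fun a => ¬ p a) (by rw [← hW₀]; exact h0z)
    have eW : (∑ a ∈ s, w a) = W₁ := by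
      rw [← sum_filter_add_sum_filter_not s p w, ← hW₀, h0z, add_zero]
    have eA : (∑ a ∈ s, w a * F a) = ∑ a ∈ s.filter p, w a * F a := by
      rw [← sum_filter_add_sum_filter_not s p, hA F, add_zero]
    have eB : (∑ a ∈ s, w a * G a) = ∑ a ∈ s.filter p, w a * G a := by
      rw [← sum_filter_add_sum_filter_not s p, hA G, add_zero]
    have eC : (∑ a ∈ s, w a * (F a * G a)) = ∑ a ∈ s.filter p, w a * (F a * G a) := by
      rw [← sum_filter_add_sum_filter_not s p, hA (fun a => F a * G a), add_zero]
    rw [eW, eA, eB, eC, hW₁]; exact h₁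
  -- generic case: divide the identity by W₁ W₀ > 0
  have hpos : 0 < W₁ * W₀ := mul_pos (lt_of_le_of_ne hW₁0 (Ne.symm h1z)) (lt_of_le_of_ne hW₀0 (Ne.symm h0z))
  have hWtot : 0 ≤ ∑ a ∈ s, w a := sum_nonneg hw
  have hrhs : 0 ≤ W₁ * W₀ *
      ((∑ a ∈ s, w a) * (∑ a ∈ s, w a * (F a * G a)) - (∑ a ∈ s, w a * F a) * (∑ a ∈ s, w a * G a)) := by
    rw [hW₁, hW₀, hid]
    have t1 : 0 ≤ (∑ a ∈ s.filter (fun a => ¬ p a), w a) * (∑ a ∈ s, w a) *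
        ((∑ a ∈ s.filter p, w a) * (∑ a ∈ s.filter p, w a * (F a * G a))
          - (∑ a ∈ s.filter p, w a * F a) * (∑ a ∈ s.filter p, w a * G a)) :=
      mul_nonneg (mul_nonneg hW₀0 hWtot) (by linarith)
    have t2 : 0 ≤ (∑ a ∈ s.filter p, w a) * (∑ a ∈ s, w a) *
        ((∑ a ∈ s.filter (fun a => ¬ p a), w a) * (∑ a ∈ s.filter (fun a => ¬ p a), w a * (F a * G a))
          - (∑ a ∈ s.filter (fun a => ¬ p a), w a * F a) * (∑ a ∈ s.filter (fun a => ¬ p a), w a * G a)) :=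
      mul_nonneg (mul_nonneg hW₁0 hWtot) (by linarith)
    linarith
  nlinarith [hrhs, hpos]

/-- Application form used by the certificates: if the weighted covariance numerator of `F, G` on `s` is nonnegative and `F` has weighted mean zero
(e.g. `F = Δf` under a swap-invariant weight), then `Σ_s w F G ≥ 0` as soon as the total weight is positive.
[cite: KozmaNitzan2024, §5.5 (context only)] -/
theorem sum_mul_nonneg_of_cov_nonneg (s : Finset α) (w F G : α → ℝ)
    (hW : 0 < ∑ a ∈ s, w a) (hA : (∑ a ∈ s, w a * F a) = 0)
    (hcov : (∑ a ∈ s, w a * F a) * (∑ a ∈ s, w a * G a) ≤ (∑ a ∈ s, w a) * (∑ a ∈ s, w a * (F a * G a))) :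
    0 ≤ ∑ a ∈ s, w a * (F a * G a) := by
  rw [hA, zero_mul] at hcov
  exact (mul_nonneg_iff_of_pos_left hW).mp hcov

end Coefficientwise

end Summit.CriticalPhenomena.PercolationContinuityZ3.Theorems
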